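import Summits.QuantumFields.BalabanUV.T4Continuum.E3Cert.ZL3d2AllU.Data
/-! E3 certificate package `ZL3d2AllU` — module `S2` ((2,3,1) block, d = 2, L = 3, all-U; emitter `bal_e3_lean_emit.py` output for
`block-L3d2-su2-allU-dyadic.json`, lane `run/shared/lean/ttrl/balaban-calc/e3/lean-draft/tree/zL3d2AllU/S2.lean`; TREE COPY by the substrate cell (seat p2), typer
ruling (μ3)(e), journal l.19196, following the E3 PILOT's scripted road (`substrate/p3/E3-PILOT.md`): import prefix substituted and one-line
docstrings added BY SCRIPT, no literal touched).  Meaning of the certificate: see `Data.lean` ∕ `Main.lean` of this package and the checker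
`E3Cert/E3PolyCertZ*.lean`.  HONEST: certified computation on ONE small block — NOT Prop. (1.8), NOT an input of any NE row today, NOT infinite
volume ∕ mass gap ∕ Clay. -/
set_option maxRecDepth 200000
set_option maxHeartbeats 0
namespace E3Z
/-- E3 certificate `zL3d2AllU` component: `zL3d2AllU_sl16` (lane output, transcribed verbatim; see the module docstring). -/
theorem zL3d2AllU_sl16 : GramCert.mainSlice zL3d2AllU 16 = true := by
  decide +kernel
/-- E3 certificate `zL3d2AllU` component: `zL3d2AllU_sl17` (lane output, transcribed verbatim; see the module docstring). -/
theorem zL3d2AllU_sl17 : GramCert.mainSlice zL3d2AllU 17 = true := by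
  decide +kernel
/-- E3 certificate `zL3d2AllU` component: `zL3d2AllU_sl18` (lane output, transcribed verbatim; see the module docstring). -/
theorem zL3d2AllU_sl18 : GramCert.mainSlice zL3d2AllU 18 = true := by
  decide +kernel
/-- E3 certificate `zL3d2AllU` component: `zL3d2AllU_sl19` (lane output, transcribed verbatim; see the module docstring). -/
theorem zL3d2AllU_sl19 : GramCert.mainSlice zL3d2AllU 19 = true := by
  decide +kernel
/-- E3 certificate `zL3d2AllU` component: `zL3d2AllU_sl20` (lane output, transcribed verbatim; see the module docstring). -/
theorem zL3d2AllU_sl20 : GramCert.mainSlice zL3d2AllU 20 = true := by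
  decide +kernel
/-- E3 certificate `zL3d2AllU` component: `zL3d2AllU_sl21` (lane output, transcribed verbatim; see the module docstring). -/
theorem zL3d2AllU_sl21 : GramCert.mainSlice zL3d2AllU 21 = true := by
  decide +kernel
/-- E3 certificate `zL3d2AllU` component: `zL3d2AllU_sl22` (lane output, transcribed verbatim; see the module docstring). -/
theorem zL3d2AllU_sl22 : GramCert.mainSlice zL3d2AllU 22 = true := by
  decide +kernel
/-- E3 certificate `zL3d2AllU` component: `zL3d2AllU_sl23` (lane output, transcribed verbatim; see the module docstring). -/
theorem zL3d2AllU_sl23 : GramCert.mainSlice zL3d2AllU 23 = true := by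
  decide +kernel
end E3Z
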